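import Summits.QuantumFields.BalabanUV.T4Continuum.Support.NE9WeightedClauseEnd
import Summits.QuantumFields.BalabanUV.T4Continuum.Support.NE9LinSizePinned
import Summits.QuantumFields.BalabanUV.T4Continuum.Support.NE9LinSizeKP

/-!
# NE9LinSizeEnd — E5′: the torus END face of the P2 road with EVERY geometry / entropy binder discharged in Bałaban's d-currency
(ADDITIVE rate condition, κ-free constants, `ε·e^{a″(ν+1)}`-type smallness; NO division of the rate by `2^ν`, NO `e^{a+a′}`) — repair
item NE9-F8 «d-currency dischargers», PART 2, STAGE B-ii = crew row (w13) part 2 of row NE9 (cell `pub-balaban`, T4-DAG §2 node U3 /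
§6 NE9; unit `b2b-balaban-t4-ne9-formalise-leaf-10`, gen 2)

HONEST FRAMING (T4-DAG PAGE 1).  Rung (B)+1 on a FIXED finite torus — NOT infinite volume, NOT a mass gap, NOT the Clay problem.
NE9 is a cell NEW ESTIMATE, NOT PRINTED, and is NOT discharged here; every analytic input stays a DISPLAYED binder ((A″) the
(2.38)-TYPE decay of the box majorant in `d`, uniformly over the admissible box — GAPS G-ne9p2-5; (L‴) the (2.20)-summand decay of
the coefficient tables; the recursion side); [I]/[II] are quoted for TYPES only (ABSOLUTE RULE); `FlowStep.BetaPertH`, (B), (B^μ)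
do not occur.  HONEST DEPENDENCY (verbatim): continuum YM on T⁴ ⇐ BetaPertH ∧ nine spine estimates (0/9 proved); BetaPertH ⇐ (D1)
∧ (D4) ∧ CAP+tail; G-an2-4 gates asym, D1 and NE2/3/4.

WHY (journal finding F-ne9leaf01-1, owner ruling l.6787).  The tree's torus faces E2 / E5
(`T4HistoryLipschitzLinearSize.torus_ne9_and_fadingMemory_of_linSizeDecay`, `NE9PrintedMajorantDecay.torus_ne9_and_fadingMemory_of_printedDecay`)
discharge the KP clause, `DecayExtract`, `PinBudget` and the pinned sums (1.26) in CUBE-COUNT currency; priced in print's letters this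
(R) DIVIDES the NE9 rate (`κ ≤ d₁ < a′/2^ν`) and (P) puts `e^{a+a′}` into the fading product `4·lipbar·B·τ̄`, whereas print's chain
(2.27) → (2.29)–(2.30) → (2.41) extracts decay in `d_k`, converts only the entropy count to cubes and loses ADDITIVELY, with the
ε₁-smallness carrying `e^{5κ} = e^{(ν+1)κ}` ([II] p. 18 «… exp C₂κ₁ exp 5κ ≤ 1»).  NE9-F8 part 1 (`NE9LinSizeEntropy`, `NE9LinSizeKP`,
seat …-leaf-05-g2) proves the three binders in d-currency; part 2 stage A (`NE9WeightedClauseEnd`) made the END faces accept any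
currency; stage B-i (`NE9LinSizePinned`) did the lip side.  THIS FILE plugs everything together.

WHAT IS PROVED (kernel; composition BY NAME + one line of real arithmetic; 0 `def`, 0 sorry).
§1 `two_mul_one_add_card_mul_le` — the polynomial factor of the segment majorant as a per-cube prefactor: from
   `∫‖pre‖e^{boxExponent}dμ ≤ ε′ k·e^{−a′·d(γ′)}` get `2(1+#γ′)·∫… ≤ (2ε′ k)·e^{(log 2)·#γ′}·e^{−a′·d(γ′)}` (`1 + n ≤ 2ⁿ`) — the majorant
   hypothesis of `NE9LinSizeKP.kpClause_of_linSizeDecay` with `a₀ = log 2`.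
§2 **`torus_termSize_ne9_and_fadingMemory_of_linSizeDischargers`** (E5′) — on a cube chart over the torus `Fin ν → ZMod N` with
   WALL-CONNECTED domain cubes ([I] p. 257) and the d-currency comparability `κ·C.d X ≤ a″·d(cubes X)`: `TermSize E W κ N ∧ NE9 E W κ
   (prodModuli ℓ fun _ => μ) ∧ FadingMemory (ℓ/μ) μ (…)` with **`μ = ω + 4·lipbar·(a₁·e^{−a″(ν+1)})·τ̄`**, from the recursion side
   (verbatim), (L‴) in `d` with `ha : 2^ν·log 2 + log(8ν) ≤ a`, `hliplb : α₄(k)·2^(ν+1+2^ν) ≤ lip k` (stage B-i), (A″) in `d` (TYPE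
   (2.38)) with the ADDITIVE rate condition **`2^ν·log 2 + log(8ν) ≤ a′ − a″ − 2^ν·(a₁ + log 2)`** and the smallness
   **`(D+1)·(2ε′ k)·e^{a″(ν+1) + 2^ν(a₁ + log 2)}·2^(ν+1+2^ν) ≤ a₁`**, and (N) `p₀ j + a₁·e^{−a″(ν+1)} ≤ N (j+1)`.  Composition:
   `NE9WeightedClauseEnd.termSize_and_ne9_of_weightedClause` ∘ (`NE9LinSizeKP.kpClause_of_linSizeDecay` ∘ §1,
   `CubeChart.decayExtract_linSize`, `CubeChart.pinBudget_linSize`, `NE9LinSizePinned.pin_of_linSizeDecay` ∘ `coeffSum_le_of_pinned`).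
§3 `…_of_dLe` — the same with the comparability split as `C.d X ≤ d(cubes X)` (the carriers' `d` IS Bałaban's `d_k`, [dict]) and
   **`κ ≤ a″`**: the END's rate is bounded by the decay-weight rate, ADDITIVELY below the majorant's rate `a′` — (R) repaired; and no
   `e^{a}`, `e^{a′}` occurs in any binder — (P) repaired (the remaining exponential `e^{a″(ν+1)}` is print's `e^{5κ}`).
DISGUISE TEST.  Every discharged binder is a ONE-history statement (configuration-free majorants, coefficient tables, lattice
geometry) at the occurring coupling; no second history, no coupling difference — not NE9 in disguise.  NOT DONE HERE: the same face
on the multi-scale chart `NE9MultiScaleChart.msChart` (site type `Σ k, Fin ν → ZMod (n k)`; needs the fibre transfer of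
`boxMajorantDecay_of_linSizeDecay_ms` for the three binders) — recorded for the row.

References (TYPES only): [Balaban1988RG2Cluster] T. Bałaban, CMP 116 (1988) (1.26) p. 8, (1.36) p. 9, (2.11)–(2.15) pp. 14–15,
(2.18)–(2.20) p. 16, (2.23)–(2.27) pp. 17–18, (2.29)–(2.30) p. 18, Lemma 3 (2.38) p. 20, (2.40)–(2.41) p. 21 and p. 21 text, p. 18
text; [Balaban1987RG1] CMP 109 (1987) (0.23) p. 256, (0.26) p. 257, p. 257, (1.18) p. 263; [KoteckyPreiss1986] CMP 103 (1986) (1)–(3);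
[FriedliVelenik2017] Lemma 3.38.
-/

noncomputable section

namespace Summit.QuantumFields.BalabanUV.T4Continuum.NE9LinSizeEnd

open scoped BigOperators
open Metric Set MeasureTheory BoundedContinuousFunction
open Literature.Probability.LatticeModels
open Literature.MathematicalPhysics.QuantumFieldTheory
open Literature.MathematicalPhysics.QuantumFieldTheory.Balaban1983to89
open Literature.MathematicalPhysics.QuantumFieldTheory.Balaban1983to89.T4OutputRate
open Literature.MathematicalPhysics.QuantumFieldTheory.Balaban1983to89.T4ActivityLipschitz
open Literature.MathematicalPhysics.QuantumFieldTheory.Balaban1983to89.T4HistoryLipschitzRecursion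
open Literature.MathematicalPhysics.QuantumFieldTheory.Balaban1983to89.T4HistoryLipschitzOuter
open Literature.MathematicalPhysics.QuantumFieldTheory.Balaban1983to89.T4HistoryLipschitzActivity
open Literature.MathematicalPhysics.QuantumFieldTheory.Balaban1983to89.T4HistoryLipschitzEntropy
open Literature.MathematicalPhysics.QuantumFieldTheory.Balaban1983to89.T4HistoryLipschitzCubeGeometry
open Literature.MathematicalPhysics.QuantumFieldTheory.Balaban1983to89.T4HistoryLipschitzActivity (ClusterGeom)
open Literature.MathematicalPhysics.QuantumFieldTheory.Balaban1983to89.T4HistoryLipschitzSegment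
open Literature.MathematicalPhysics.QuantumFieldTheory.Balaban1983to89.T4HistoryLipschitzLinearSize
open Summit.QuantumFields.BalabanUV.T4Continuum.NE9LinSizeEntropy
open Summit.QuantumFields.BalabanUV.T4Continuum.NE9LinSizePinned
open Summit.QuantumFields.BalabanUV.T4Continuum.NE9WeightedClauseEnd
open Summit.QuantumFields.BalabanUV.T4Continuum.NE9LinSizeKP

/-! ## §1 The polynomial factor of the segment majorant as a per-cube prefactor `e^{(log 2)·#γ′}` -/

/-- **`1 + n ≤ e^{n·log 2}`** (`= 2ⁿ`) in the reals. [folklore] -/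
theorem one_add_le_exp_mul_log_two (n : ℕ) : 1 + (n : ℝ) ≤ Real.exp (Real.log 2 * (n : ℝ)) := by
  have h : n < 2 ^ n := Nat.lt_two_pow_self
  have h' : (n : ℝ) + 1 ≤ (2:ℝ) ^ n := by exact_mod_cast h
  rw [mul_comm, Real.exp_nat_mul, Real.exp_log (by norm_num : (0:ℝ) < 2)]
  linarith

/-- **THE (2.26)-TYPE MAJORANT WITH ITS POLYNOMIAL FACTOR, READ AS THE HYPOTHESIS OF `NE9LinSizeKP.kpClause_of_linSizeDecay` (kernel,
real arithmetic).**  If `I ≤ ε·e^{−a′·L}` with `ε ≥ 0`, then `2·((1 + n)·I) ≤ (2ε)·e^{(log 2)·n}·e^{−a′·L}` — used with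
`I = ∫‖pre‖e^{boxExponent}dμ`, `n = #γ′`, `L = d(γ′)`: the factor `1 + #γ′` of `segMajorant_le_one_add_mul` becomes the per-cube
prefactor slot `a₀ = log 2` of part 1b (the cube-count chain pays it as `y ↦ 2y`, `one_add_mul_pow_le`). [folklore] -/
theorem two_mul_one_add_card_mul_le {I ε a' L : ℝ} {n : ℕ} (hε : 0 ≤ ε) (hI : I ≤ ε * Real.exp (-(a' * L))) :
    2 * ((1 + (n : ℝ)) * I) ≤ (2 * ε) * Real.exp (Real.log 2 * (n : ℝ)) * Real.exp (-(a' * L)) := by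
  have hb : 0 ≤ ε * Real.exp (-(a' * L)) := mul_nonneg hε (Real.exp_nonneg _)
  have h1 : (1 + (n : ℝ)) * I ≤ (1 + (n : ℝ)) * (ε * Real.exp (-(a' * L))) :=
    mul_le_mul_of_nonneg_left hI (by positivity)
  have h2 : (1 + (n : ℝ)) * (ε * Real.exp (-(a' * L))) ≤ Real.exp (Real.log 2 * (n : ℝ)) * (ε * Real.exp (-(a' * L))) :=
    mul_le_mul_of_nonneg_right (one_add_le_exp_mul_log_two n) hb
  nlinarith

/-! ## §2 E5′: the torus END face with the KP clause, the extracted decay, the pin budget AND the pinned sums in d-currency -/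

section Torus

variable {ν N : ℕ} {C : Carriers} {D : ℕ}
variable {Bg : Type} {Sp : Type*} [TopologicalSpace Sp] [MeasurableSpace Sp] [OpensMeasurableSpace Sp] {F : Type*}
  [Fintype F] {Ω : Type*} [MeasurableSpace Ω]

/-- **E5′ — THE SIZE BOUND, NE9 ∧ FADING MEMORY ON A TORUS CUBE CHART WITH EVERY GEOMETRY / ENTROPY BINDER IN BAŁABAN'S
d-CURRENCY (kernel end-to-end).**  Compared with E5 (`NE9PrintedMajorantDecay.torus_ne9_and_fadingMemory_of_printedDecay`; both
activity-side decays already in `d`): the cube-count scalars `hθ₁`, `hliplb : α₄·e^{a}·θ₁ ≤ lip`, `y`, `hθ : 2e^{−a′/2^ν}e^{a₁+d₁}e^{Dθ} ≤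
θ`, `hεθ : 2(ε′e^{a′})θ(D+1) ≤ a₁`, `hκd : κ ≤ d₁` are GONE; displayed instead — (lip) `ha : 2^ν·log 2 + log(8ν) ≤ a`,
`hliplb : α₄(k)·2^(ν+1+2^ν) ≤ lip k` ((1.26) in `d`, `NE9LinSizeEntropy`/`NE9LinSizePinned`); (KP) the ADDITIVE rate condition
`hrate : 2^ν·log 2 + log(8ν) ≤ a′ − a″ − 2^ν·(a₁ + log 2)` and `hsmall : (D+1)·(2ε′ k)·e^{a″(ν+1)+2^ν(a₁+log 2)}·2^(ν+1+2^ν) ≤ a₁`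
(`NE9LinSizeKP.kpClause_of_linSizeDecay`, prefactor slot `a₀ = log 2` for the factor `1 + #γ′`); (geometry) `hXconn` — the cubes of
every domain are WALL-CONNECTED ([I] p. 257 «Such a domain is a union of a connected, finite family of cubes») — for
`CubeChart.decayExtract_linSize` (= (2.27) p. 18 BY NAME), and the d-currency comparability `hcmp : κ·C.d X ≤ a″·d(cubes X)` for
`CubeChart.pinBudget_linSize` (envelope `B = a₁·e^{−a″(ν+1)}`); (N) `p₀ j + a₁·e^{−a″(ν+1)} ≤ N (j+1)`.  Conclusion: `TermSize E W κ N`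
and the END with rate letter **`μ = ω + 4·lipbar·(a₁·e^{−a″(ν+1)})·τ̄`**.  Composition BY NAME:
`NE9WeightedClauseEnd.termSize_and_ne9_of_weightedClause` at `a = sizeWeight a₁`, `d γ = a″·(d(γ) + (ν+1))`, `δ X = a″·(d(cubes X) +
(ν+1))`.  (A″)/(L‴)/the recursion side DISPLAYED, nothing of [I]–[III] asserted; rung (B)+1 bookkeeping on a finite torus.
[cite: Balaban1988RG2Cluster, (1.26) p.8, (1.36) p.9, (2.18)-(2.20) p.16, (2.26)-(2.27) pp.17-18, (2.30) p.18, Lemma 3 (2.38) p.20, (2.40)-(2.41) p.21 and p.21 text; Balaban1987RG1, (0.23) p.256, p.257, (1.18) p.263; KoteckyPreiss1986, (1)-(3)] -/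
theorem torus_termSize_ne9_and_fadingMemory_of_linSizeDischargers (Γ : CubeChart C (Fin ν → ZMod N) (torusAdj ν N) D)
    {ι : Type} {E : Functional C Bg}
    {W : Set (ℕ → ℝ)} {Adm : Set (Bg → C.Dom → ℝ)} {T : ℕ → (ℕ → ℝ) → (Bg → C.Dom → ℝ) → ι → ℝ}
    {Ψ : ℕ → ℝ → (ι → ℝ) → Bg → C.Dom → ℝ}
    {μ : ℕ → ℝ → Bg → Finset (Fin ν → ZMod N) → Measure Ω} {pre : ℕ → ℝ → Bg → Finset (Fin ν → ZMod N) → Ω → ℂ}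
    {c : ℕ → ℝ → Bg → Finset (Fin ν → ZMod N) → Ω → F → ℂ}
    {pt : ℕ → ℝ → Bg → Finset (Fin ν → ZMod N) → Ω → F → Sp} {β : ℕ → Sp → ℝ}
    {dom : ℕ → Finset (Fin ν → ZMod N) → F → Finset (Fin ν → ZMod N)}
    {lip ε' α4 : ℕ → ℝ} {a₁ a'' κ lipbar ℓ τbar ω a a' : ℝ} {wt : ℕ → ι → ℝ} {τ : ℕ → ℕ → ℝ} {lam p₀ Nsz : ℕ → ℝ}
    (ρ : ℕ → (ι → ℝ) → (Sp →ᵇ ℂ))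
    -- recursion side (displayed, named binders of the P2 leaves)
    (h0 : ScaleZeroFree E W) (hAdm : AdmissibleTerms E W Adm) (hres : AdmRestrict Adm)
    (hadd : ChannelAdditive Adm T) (hsum : ChannelStepSum Adm T) (hstep : ChannelSizeAtStepNN Adm T κ wt τ)
    (hfac : Factorises E W T Ψ) (hlast : LastCouplingLipschitz E W T Ψ κ lam)
    (hρ : ∀ (k : ℕ) (P P' : ι → ℝ) (M : ℝ), (∀ y, |P y - P' y| ≤ wt k y * M) → ‖ρ k P - ρ k P'‖ ≤ M)
    (hΨ : ∀ (k : ℕ) (s : ℝ) (P P' : ι → ℝ) (U : Bg) (X : C.Dom),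
      Ψ k s P U X - Ψ k s P' U X =
        (Γ.geom.newTerm (Γ.geom.avgExpLinearAct μ pre fun k s U γ ω => evalFunctional (c k s U γ ω) (pt k s U γ ω))
            k s U X (ρ k P) -
          Γ.geom.newTerm (Γ.geom.avgExpLinearAct μ pre fun k s U γ ω => evalFunctional (c k s U γ ω) (pt k s U γ ω))
            k s U X (ρ k P')).re)
    -- the size-induction data (B0), (X), (N) with B = a₁·e^{−a″(ν+1)}, (R′)
    (hexpl : ∀ g ∈ W, ∀ (k : ℕ) (P : ι → ℝ) (U : Bg) (X : C.Dom), C.scale X = k + 1 →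
      |Ψ k (g k) P U X -
          (Γ.geom.newTerm (Γ.geom.avgExpLinearAct μ pre fun k s U γ ω => evalFunctional (c k s U γ ω) (pt k s U γ ω))
            k (g k) U X (ρ k P)).re| ≤ Real.exp (-(κ * C.d X)) * p₀ k)
    (hbase : ∀ g ∈ W, ∀ (U : Bg) (X : C.Dom), C.scale X = 0 → |E g U X| ≤ Real.exp (-(κ * C.d X)) * Nsz 0)
    (hNsucc : ∀ j, p₀ j + a₁ * Real.exp (-(a'' * (ν + 1))) ≤ Nsz (j + 1)) (hNnn : ∀ j, 0 ≤ Nsz j)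
    (hbox : ∀ (k : ℕ) (P : ι → ℝ), (∀ y, |P y| ≤ wt k y * sizeRadius τ Nsz k) → ∀ x, ‖ρ k P x‖ ≤ β k x)
    -- activity side: regularity data, scales, ONE integrability, support of the coefficients
    (hpre : ∀ k s U γ, AEStronglyMeasurable (pre k s U γ) (μ k s U γ))
    (hc : ∀ k s U γ Y, AEStronglyMeasurable (fun ω => c k s U γ ω Y) (μ k s U γ))
    (hpt : ∀ k s U γ Y, Measurable fun ω => pt k s U γ ω Y) (hlip : ∀ k, 0 < lip k) (hlipb : ∀ k, lip k ≤ lipbar)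
    (hint₀ : ∀ k s U γ, Integrable (fun ω => ‖pre k s U γ ω‖ * Real.exp (boxExponent c pt β k s U γ ω)) (μ k s U γ))
    (hmeet : ∀ k s U (γ : Finset (Fin ν → ZMod N)) ω Y, c k s U γ ω Y ≠ 0 → ∃ x ∈ γ, x ∈ dom k γ Y)
    -- (L‴) decay of the coefficient tables in `d` + the pinned sums (1.26) in `d` (stage B-i letters)
    (hα4 : ∀ k, 0 ≤ α4 k) (ha : (2:ℝ) ^ ν * Real.log 2 + Real.log (8 * ν) ≤ a)
    (hliplb : ∀ k, α4 k * 2 ^ (ν + 1 + 2 ^ ν) ≤ lip k)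
    (hlin : ∀ k s U (γ : Finset (Fin ν → ZMod N)) ω Y,
      ‖c k s U γ ω Y‖ ≤ α4 k * Real.exp (-(a * (linSize (dom k γ Y) : ℝ))))
    (hdomconn : ∀ k (γ : Finset (Fin ν → ZMod N)) Y, (dom k γ Y).Nonempty →
      ∃ b ∈ dom k γ Y, Polymer.IsConn (torusAdj ν N) (dom k γ Y) b)
    (hdominj : ∀ k (γ : Finset (Fin ν → ZMod N)), Set.InjOn (dom k γ) {Y | (dom k γ Y).Nonempty})
    -- the d-currency geometry: wall-connected domain cubes ([I] p.257), comparability `κ·C.d X ≤ a″·d(cubes X)`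
    (hXconn : ∀ X, ∃ b, Polymer.IsConn (torusAdj ν N) (Γ.cubes X) b)
    (hcmp : ∀ X, κ * C.d X ≤ a'' * (linSize (Γ.cubes X) : ℝ))
    -- (A″) decay of the box majorant in `d` (TYPE (2.38)) with the ADDITIVE rate condition and the smallness of part 1b
    (hε' : ∀ k, 0 ≤ ε' k)
    (hdecayLin : ∀ g ∈ W, ∀ (k : ℕ) (U : Bg) (X : C.Dom), C.scale X = k + 1 → ∀ γ' ∈ Γ.vol X,
      ∫ ω, ‖pre k (g k) U γ' ω‖ * Real.exp (boxExponent c pt β k (g k) U γ' ω) ∂(μ k (g k) U γ') ≤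
        ε' k * Real.exp (-(a' * (linSize γ' : ℝ))))
    (ha₁ : 0 ≤ a₁) (ha'' : 0 ≤ a'')
    (hrate : (2:ℝ) ^ ν * Real.log 2 + Real.log (8 * ν) ≤ a' - a'' - 2 ^ ν * (a₁ + Real.log 2))
    (hsmall : ∀ k, ((D : ℝ) + 1) * (2 * ε' k) * Real.exp (a'' * (ν + 1) + 2 ^ ν * (a₁ + Real.log 2)) *
      2 ^ (ν + 1 + 2 ^ ν) ≤ a₁)
    -- envelope data
    (hℓ : 0 ≤ ℓ) (hτbar : 0 ≤ τbar) (hω : 0 ≤ ω) (hpos : 0 < ω + 4 * lipbar * (a₁ * Real.exp (-(a'' * (ν + 1)))) * τbar)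
    (hlam : ∀ k, lam k ≤ ℓ) (hτ : ∀ k j, j ≤ k → 0 ≤ τ k j ∧ τ k j ≤ τbar * ω ^ (k - j)) :
    TermSize E W κ Nsz ∧
      NE9 E W κ (prodModuli ℓ fun _ => ω + 4 * lipbar * (a₁ * Real.exp (-(a'' * (ν + 1)))) * τbar) ∧
        FadingMemory (ℓ / (ω + 4 * lipbar * (a₁ * Real.exp (-(a'' * (ν + 1)))) * τbar))
          (ω + 4 * lipbar * (a₁ * Real.exp (-(a'' * (ν + 1)))) * τbar)
          (prodModuli ℓ fun _ => ω + 4 * lipbar * (a₁ * Real.exp (-(a'' * (ν + 1)))) * τbar) := by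
  -- (L′) from (L‴) in d-currency (stage B-i)
  have hL : ∀ k s U (γ : Finset (Fin ν → ZMod N)) ω, coeffSum c k s U γ ω ≤ lip k * (γ.card : ℝ) :=
    coeffSum_le_of_pinned hmeet
      (pin_of_linSizeDecay (G := ZMod N) hα4 ha hliplb hlin (fun k γ Y hY => hdomconn k γ Y hY) hdominj)
  -- the KP clause on the box majorant in d-currency (part 1b ∘ §1)
  have hM0 : ∀ (k : ℕ) (s : ℝ) (U : Bg) (γ' : Finset (Fin ν → ZMod N)),
      0 ≤ 2 * ((1 + ((γ' : Finset (Fin ν → ZMod N)).card : ℝ)) *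
        ∫ ω, ‖pre k s U γ' ω‖ * Real.exp (boxExponent c pt β k s U γ' ω) ∂(μ k s U γ')) := fun k s U γ' =>
    mul_nonneg (by norm_num) (mul_nonneg (by positivity)
      (integral_nonneg fun _ => mul_nonneg (norm_nonneg _) (Real.exp_pos _).le))
  have hkp := kpClause_of_linSizeDecay Γ.supported (fun _ _ h => h) (W := W)
    (M := fun k s U γ' => 2 * ((1 + ((γ' : Finset (Fin ν → ZMod N)).card : ℝ)) *
      ∫ ω, ‖pre k s U γ' ω‖ * Real.exp (boxExponent c pt β k s U γ' ω) ∂(μ k s U γ')))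
    (ε := fun k => 2 * ε' k) (a₀ := Real.log 2) (fun k => by have := hε' k; positivity) hM0
    (fun g hg k U X hX γ' hγ' => two_mul_one_add_card_mul_le (hε' k) (hdecayLin g hg k U X hX γ' hγ'))
    ha₁ (Real.log_nonneg (by norm_num)) hrate hsmall
  have hB : 0 ≤ a₁ * Real.exp (-(a'' * (ν + 1))) := mul_nonneg ha₁ (Real.exp_nonneg _)
  exact termSize_and_ne9_of_weightedClause Γ ρ h0 hAdm hres hadd hsum hstep hfac hlast hρ hΨ hexpl hbase hNsucc hNnn hbox
    hpre hc hpt hlip hlipb hint₀ hL (Γ.supported.sizeWeight_nonneg ha₁)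
    (fun γ => mul_nonneg ha'' (by positivity)) hkp
    (decayExtract_linSize Γ (fun _ _ h => h) ha'' hXconn) (pinBudget_linSize Γ ha₁ hcmp) hB hℓ hτbar hω hpos hlam hτ

/-- **E5′ WITH THE RATE DISPLAYED AS `κ ≤ a″` (kernel).**  §2 with the comparability split into the DICTIONARY clause «the carriers'
decay length is Bałaban's `d_k` of the domain's cubes» (`C.d X ≤ d(cubes X)`; EQUALITY on `NE9MultiScaleChart.msCarriers`, [I]
p. 257) and the rate inequality **`κ ≤ a″`**: the NE9 rate delivered is the decay-weight rate `a″`, itself ADDITIVELY below the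
majorant's d-rate `a′` by `hrate` — print's «κ ≥ κ₀»-type loss of (2.29)–(2.30)/(2.41), not the division `κ < a′/2^ν` of the
cube-count faces (F-ne9leaf01-1 (R)); and no binder contains `e^{a}` or `e^{a′}` ((P)): the only exponential left, `e^{a″(ν+1)}` in
`hsmall` and in `B = a₁e^{−a″(ν+1)}`, is print's `e^{5κ}` of p. 18 / p. 21. [cite: Balaban1988RG2Cluster, (2.29)-(2.30) p.18, (2.41) p.21, p.18 text; Balaban1987RG1, p.257] -/
theorem torus_termSize_ne9_and_fadingMemory_of_linSizeDischargers_of_dLe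
    (Γ : CubeChart C (Fin ν → ZMod N) (torusAdj ν N) D) {ι : Type} {E : Functional C Bg}
    {W : Set (ℕ → ℝ)} {Adm : Set (Bg → C.Dom → ℝ)} {T : ℕ → (ℕ → ℝ) → (Bg → C.Dom → ℝ) → ι → ℝ}
    {Ψ : ℕ → ℝ → (ι → ℝ) → Bg → C.Dom → ℝ}
    {μ : ℕ → ℝ → Bg → Finset (Fin ν → ZMod N) → Measure Ω} {pre : ℕ → ℝ → Bg → Finset (Fin ν → ZMod N) → Ω → ℂ}
    {c : ℕ → ℝ → Bg → Finset (Fin ν → ZMod N) → Ω → F → ℂ}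
    {pt : ℕ → ℝ → Bg → Finset (Fin ν → ZMod N) → Ω → F → Sp} {β : ℕ → Sp → ℝ}
    {dom : ℕ → Finset (Fin ν → ZMod N) → F → Finset (Fin ν → ZMod N)}
    {lip ε' α4 : ℕ → ℝ} {a₁ a'' κ lipbar ℓ τbar ω a a' : ℝ} {wt : ℕ → ι → ℝ} {τ : ℕ → ℕ → ℝ} {lam p₀ Nsz : ℕ → ℝ}
    (ρ : ℕ → (ι → ℝ) → (Sp →ᵇ ℂ))
    (h0 : ScaleZeroFree E W) (hAdm : AdmissibleTerms E W Adm) (hres : AdmRestrict Adm)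
    (hadd : ChannelAdditive Adm T) (hsum : ChannelStepSum Adm T) (hstep : ChannelSizeAtStepNN Adm T κ wt τ)
    (hfac : Factorises E W T Ψ) (hlast : LastCouplingLipschitz E W T Ψ κ lam)
    (hρ : ∀ (k : ℕ) (P P' : ι → ℝ) (M : ℝ), (∀ y, |P y - P' y| ≤ wt k y * M) → ‖ρ k P - ρ k P'‖ ≤ M)
    (hΨ : ∀ (k : ℕ) (s : ℝ) (P P' : ι → ℝ) (U : Bg) (X : C.Dom),
      Ψ k s P U X - Ψ k s P' U X =
        (Γ.geom.newTerm (Γ.geom.avgExpLinearAct μ pre fun k s U γ ω => evalFunctional (c k s U γ ω) (pt k s U γ ω))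
            k s U X (ρ k P) -
          Γ.geom.newTerm (Γ.geom.avgExpLinearAct μ pre fun k s U γ ω => evalFunctional (c k s U γ ω) (pt k s U γ ω))
            k s U X (ρ k P')).re)
    (hexpl : ∀ g ∈ W, ∀ (k : ℕ) (P : ι → ℝ) (U : Bg) (X : C.Dom), C.scale X = k + 1 →
      |Ψ k (g k) P U X -
          (Γ.geom.newTerm (Γ.geom.avgExpLinearAct μ pre fun k s U γ ω => evalFunctional (c k s U γ ω) (pt k s U γ ω))
            k (g k) U X (ρ k P)).re| ≤ Real.exp (-(κ * C.d X)) * p₀ k)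
    (hbase : ∀ g ∈ W, ∀ (U : Bg) (X : C.Dom), C.scale X = 0 → |E g U X| ≤ Real.exp (-(κ * C.d X)) * Nsz 0)
    (hNsucc : ∀ j, p₀ j + a₁ * Real.exp (-(a'' * (ν + 1))) ≤ Nsz (j + 1)) (hNnn : ∀ j, 0 ≤ Nsz j)
    (hbox : ∀ (k : ℕ) (P : ι → ℝ), (∀ y, |P y| ≤ wt k y * sizeRadius τ Nsz k) → ∀ x, ‖ρ k P x‖ ≤ β k x)
    (hpre : ∀ k s U γ, AEStronglyMeasurable (pre k s U γ) (μ k s U γ))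
    (hc : ∀ k s U γ Y, AEStronglyMeasurable (fun ω => c k s U γ ω Y) (μ k s U γ))
    (hpt : ∀ k s U γ Y, Measurable fun ω => pt k s U γ ω Y) (hlip : ∀ k, 0 < lip k) (hlipb : ∀ k, lip k ≤ lipbar)
    (hint₀ : ∀ k s U γ, Integrable (fun ω => ‖pre k s U γ ω‖ * Real.exp (boxExponent c pt β k s U γ ω)) (μ k s U γ))
    (hmeet : ∀ k s U (γ : Finset (Fin ν → ZMod N)) ω Y, c k s U γ ω Y ≠ 0 → ∃ x ∈ γ, x ∈ dom k γ Y)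
    (hα4 : ∀ k, 0 ≤ α4 k) (ha : (2:ℝ) ^ ν * Real.log 2 + Real.log (8 * ν) ≤ a)
    (hliplb : ∀ k, α4 k * 2 ^ (ν + 1 + 2 ^ ν) ≤ lip k)
    (hlin : ∀ k s U (γ : Finset (Fin ν → ZMod N)) ω Y,
      ‖c k s U γ ω Y‖ ≤ α4 k * Real.exp (-(a * (linSize (dom k γ Y) : ℝ))))
    (hdomconn : ∀ k (γ : Finset (Fin ν → ZMod N)) Y, (dom k γ Y).Nonempty →
      ∃ b ∈ dom k γ Y, Polymer.IsConn (torusAdj ν N) (dom k γ Y) b)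
    (hdominj : ∀ k (γ : Finset (Fin ν → ZMod N)), Set.InjOn (dom k γ) {Y | (dom k γ Y).Nonempty})
    (hXconn : ∀ X, ∃ b, Polymer.IsConn (torusAdj ν N) (Γ.cubes X) b)
    -- the [dict] clause and the ADDITIVE rate: `C.d = d_k` on the cubes, `κ ≤ a″`
    (hdle : ∀ X, C.d X ≤ (linSize (Γ.cubes X) : ℝ)) (hκ : 0 ≤ κ) (hκa : κ ≤ a'')
    (hε' : ∀ k, 0 ≤ ε' k)
    (hdecayLin : ∀ g ∈ W, ∀ (k : ℕ) (U : Bg) (X : C.Dom), C.scale X = k + 1 → ∀ γ' ∈ Γ.vol X,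
      ∫ ω, ‖pre k (g k) U γ' ω‖ * Real.exp (boxExponent c pt β k (g k) U γ' ω) ∂(μ k (g k) U γ') ≤
        ε' k * Real.exp (-(a' * (linSize γ' : ℝ))))
    (ha₁ : 0 ≤ a₁)
    (hrate : (2:ℝ) ^ ν * Real.log 2 + Real.log (8 * ν) ≤ a' - a'' - 2 ^ ν * (a₁ + Real.log 2))
    (hsmall : ∀ k, ((D : ℝ) + 1) * (2 * ε' k) * Real.exp (a'' * (ν + 1) + 2 ^ ν * (a₁ + Real.log 2)) *
      2 ^ (ν + 1 + 2 ^ ν) ≤ a₁)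
    (hℓ : 0 ≤ ℓ) (hτbar : 0 ≤ τbar) (hω : 0 ≤ ω) (hpos : 0 < ω + 4 * lipbar * (a₁ * Real.exp (-(a'' * (ν + 1)))) * τbar)
    (hlam : ∀ k, lam k ≤ ℓ) (hτ : ∀ k j, j ≤ k → 0 ≤ τ k j ∧ τ k j ≤ τbar * ω ^ (k - j)) :
    TermSize E W κ Nsz ∧
      NE9 E W κ (prodModuli ℓ fun _ => ω + 4 * lipbar * (a₁ * Real.exp (-(a'' * (ν + 1)))) * τbar) ∧
        FadingMemory (ℓ / (ω + 4 * lipbar * (a₁ * Real.exp (-(a'' * (ν + 1)))) * τbar))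
          (ω + 4 * lipbar * (a₁ * Real.exp (-(a'' * (ν + 1)))) * τbar)
          (prodModuli ℓ fun _ => ω + 4 * lipbar * (a₁ * Real.exp (-(a'' * (ν + 1)))) * τbar) :=
  torus_termSize_ne9_and_fadingMemory_of_linSizeDischargers Γ ρ h0 hAdm hres hadd hsum hstep hfac hlast hρ hΨ hexpl hbase hNsucc
    hNnn hbox hpre hc hpt hlip hlipb hint₀ hmeet hα4 ha hliplb hlin hdomconn hdominj hXconn
    (fun X => (mul_le_mul_of_nonneg_left (hdle X) hκ).trans (mul_le_mul_of_nonneg_right hκa (Nat.cast_nonneg _)))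
    hε' hdecayLin ha₁ (hκ.trans hκa) hrate hsmall hℓ hτbar hω hpos hlam hτ

end Torus

end Summit.QuantumFields.BalabanUV.T4Continuum.NE9LinSizeEnd

end
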